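import Summits.NavierStokesRegularity.FluidComputer.TerminalWindowFloor

/-!
# Fluid computer — the SATURATION RELAY of a blow-up: every event is followed by a strictly higher, strictly later one

HONEST FRAMING (cell `pub-fluidc`, verbatim): *low prior, high value-of-information experiment on Tao's
machine paradigm; NOT a claim that NS blows up.* Theorem side of the cell; nothing here is evidence of blow-up.

RULING R35 (HOME/STATUS l.3987, F4) asks the theorem side for "the two-consecutive-levels corollary the atlas will
cite" next to the clock floor: the pass's question is whether a designed level-one step is HANDED ON — `r ≥ 1` at the
next level with the second band peaking AFTER the first. On the theorem side the hand-off is a necessity in the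
following precise sense (events = saturated (level, time) pairs of Cheskidov–Shvydkoy, `‖Δ̇_q u(t)‖_∞ ≥ b ν 2^q`,
tree `Literature.Analysis.FluidPDE.IsSaturatedLevel`):

* `exists_later_higher_saturated` (**L10**) — along a maximal smooth solution which is Leray–Hopf from `u 0`, every
  pair `(q₁, t₁)` with `t₁ < T` is followed by a saturation event `(q₂, t₂)` with `q₁ < q₂`, `t₁ < t₂ < T`
  (from `TerminalWindowFloor.exists_saturated_after'`, i.e. Cheskidov–Shvydkoy 2010 Lemma 3.2 restarted in the
  window `(t₁, T)`);
* `exists_strictMono_saturation_chain` (**L10′**) — hence an infinite chain of events strictly increasing in level AND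
  in time: a realised blow-up is an endless upward relay. A trajectory whose upward hand-offs stop — level one met, the
  next level sub-null and peaking earlier, as on the cell's certified break-point field (RULING R34: "ONE-SHOT
  focusing by the data") — is, read against L10′, not a blow-up segment. Necessity only; no sufficiency is claimed,
  and adjacent indices `q₂ = q₁ + 1` are NOT asserted (the relay may skip levels).

0 sorry; no new definitions or named facts.

## References

* A. Cheskidov, R. Shvydkoy, Arch. Ration. Mech. Anal. 195 (2010) 159–169, Lemma 3.2. [CheskidovShvydkoy2010]
-/

noncomputable section

open MeasureTheory Set Function Filter Topology
open scoped ENNReal NNReal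
open Literature.Analysis.FluidPDE Literature.Analysis.FunctionSpaces
open Summit.NavierStokesRegularity.FluidComputer.TerminalWindowFloor

namespace Summit.NavierStokesRegularity.FluidComputer.SaturationRelay

/-- **L10 — THE HAND-OFF NEVER ENDS (the "two consecutive events" corollary for the atlas's level-two columns).**
With the absolute `c > 0` of `dyadic_floor_window`: along every maximal smooth solution `(u, p)` of the unforced
Navier–Stokes system on `ℝ³ × [0, T)` (`ν > 0`) which is Leray–Hopf from `u 0`, and for every threshold `b < c`,
EVERY (level, time) pair `(q₁, t₁)` with `t₁ < T` — in particular every saturation event — is followed by a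
saturation event `(q₂, t₂)` that is STRICTLY HIGHER and STRICTLY LATER: `q₁ < q₂`, `t₁ < t₂ < T`,
`‖Δ̇_{q₂} u(t₂)‖_∞ ≥ b ν 2^{q₂}`. Iterating, a blow-up carries an infinite chain of events increasing in level AND
in time (RULING R35's question "is the step handed on to the next level, the second band peaking AFTER the
first?" has, on the theorem side, the answer: in a blow-up it is handed on upward and forward infinitely often;
a trajectory whose upward hand-offs stop at a finite level — level one met, level two sub-null and earlier, as on
the certified break-point field — is not a blow-up segment). Immediate from `exists_saturated_after'` with the
window `(max t₁ 0, T)` and `J = q₁ + 1`. [cite: CheskidovShvydkoy2010, Lemma 3.2] -/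
theorem exists_later_higher_saturated :
    ∃ c : ℝ, 0 < c ∧ ∀ (ν T : ℝ), 0 < ν → 0 < T →
      ∀ (u : ℝ → EuclideanSpace ℝ (Fin 3) → EuclideanSpace ℝ (Fin 3)) (p : ℝ → EuclideanSpace ℝ (Fin 3) → ℝ),
      IsMaximalSmoothSolution ν 0 u p T → IsLerayHopfOn T ν 0 (u 0) u →
      ∀ b : ℝ, b < c → ∀ (q₁ : ℕ) (t₁ : ℝ), t₁ < T →
        ∃ (q₂ : ℕ) (t₂ : ℝ), q₁ < q₂ ∧ t₁ < t₂ ∧ t₂ < T ∧ IsSaturatedLevel b ν (u t₂) q₂ := by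
  obtain ⟨c, hc, H⟩ := exists_saturated_after'
  refine ⟨c, hc, fun ν T hν hT u p hmax hLH b hb q₁ t₁ ht₁ => ?_⟩
  have ht₀ : max t₁ 0 ∈ Ico 0 T := ⟨le_max_right t₁ 0, max_lt ht₁ hT⟩
  obtain ⟨q₂, hq, t₂, ht₂, hsat⟩ := H ν T hν hT u p hmax hLH (max t₁ 0) ht₀ b hb (q₁ + 1)
  exact ⟨q₂, t₂, Nat.lt_of_succ_le hq, (le_max_left t₁ 0).trans_lt ht₂.1, ht₂.2, hsat⟩

/-- **L10′ — an infinite increasing chain of saturation events.** In the setting of L10 there is a sequence of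
events `(q n, t n)` with levels `q` and times `t` BOTH strictly increasing, `t n < T`, and level `q n` saturated at
time `t n` for every `n` (by recursion on L10 from any starting pair). In cascade words: a realised blow-up is an
endless relay — each saturated level hands on to a higher level at a later time. [cite: CheskidovShvydkoy2010, Lemma 3.2] -/
theorem exists_strictMono_saturation_chain :
    ∃ c : ℝ, 0 < c ∧ ∀ (ν T : ℝ), 0 < ν → 0 < T →
      ∀ (u : ℝ → EuclideanSpace ℝ (Fin 3) → EuclideanSpace ℝ (Fin 3)) (p : ℝ → EuclideanSpace ℝ (Fin 3) → ℝ),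
      IsMaximalSmoothSolution ν 0 u p T → IsLerayHopfOn T ν 0 (u 0) u →
      ∀ b : ℝ, b < c →
        ∃ (q : ℕ → ℕ) (t : ℕ → ℝ), StrictMono q ∧ StrictMono t ∧ (∀ n, 0 < t n ∧ t n < T) ∧
          ∀ n, IsSaturatedLevel b ν (u (t n)) (q n) := by
  obtain ⟨c, hc, H⟩ := exists_later_higher_saturated
  refine ⟨c, hc, fun ν T hν hT u p hmax hLH b hb => ?_⟩
  have step := H ν T hν hT u p hmax hLH b hb
  -- events as a subtype; a successor map from L10 by choice
  let E := {e : ℕ × ℝ // 0 < e.2 ∧ e.2 < T ∧ IsSaturatedLevel b ν (u e.2) e.1}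
  have hsucc : ∀ e : E, ∃ e' : E, e.1.1 < e'.1.1 ∧ e.1.2 < e'.1.2 := by
    rintro ⟨⟨q₁, t₁⟩, h0, hT₁, -⟩
    obtain ⟨q₂, t₂, hq, ht, hT₂, hsat⟩ := step q₁ t₁ hT₁
    exact ⟨⟨(q₂, t₂), h0.trans ht, hT₂, hsat⟩, hq, ht⟩
  choose next hnext using hsucc
  -- a first event (from the pair `(0, 0)`)
  obtain ⟨q₀, t₀, -, ht₀, hT₀, hsat₀⟩ := step 0 0 hT
  let e₀ : E := ⟨(q₀, t₀), ht₀, hT₀, hsat₀⟩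
  let seq : ℕ → E := fun n => next^[n] e₀
  have hseq : ∀ n, seq (n + 1) = next (seq n) := fun n => Function.iterate_succ_apply' next n e₀
  refine ⟨fun n => (seq n).1.1, fun n => (seq n).1.2, strictMono_nat_of_lt_succ fun n => ?_,
    strictMono_nat_of_lt_succ fun n => ?_, fun n => ⟨(seq n).2.1, (seq n).2.2.1⟩, fun n => (seq n).2.2.2⟩
  · rw [hseq]; exact (hnext (seq n)).1
  · rw [hseq]; exact (hnext (seq n)).2

end Summit.NavierStokesRegularity.FluidComputer.SaturationRelay

end
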